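import Summits.BirchSwinnertonDyer.BirchSwinnertonDyer.Theorems.PrintCf2RubinValueTwoLinePinThetaLineTwist
import Summits.BirchSwinnertonDyer.BirchSwinnertonDyer.Theorems.PrintCf2SplitBadTwoLineDoubleCosetPlacesMirror
import Summits.BirchSwinnertonDyer.BirchSwinnertonDyer.Theorems.CycTangentCMCycTangentBoundSplitPrimeSaturation
import Summits.BirchSwinnertonDyer.Rank1Residual.X2.AvatarValueAboveP
import Literature.NumberTheory.GaloisRepresentations.ArtinCharacterLocalGlobalProofs
import Literature.NumberTheory.GaloisRepresentations.LocalHOneInertiaRestrictionProfinite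
import Literature.NumberTheory.EllipticCurves.CyclotomicIwasawaMainTheoremIrreducibleProofs
import Literature.NumberTheory.EllipticCurves.KellerYin2024.CharacterSelmerGroups
import HarnessLib

/-!
# M-LINE-PIN stub (A) `stub_vLineRestriction` (crux `PrintCf2RubinValueTwo.MainConjClauseAtSplitTwoQuad`,
# stmt-BirchSwinnertonDyer-24086; skeleton `Cruxes/MainConjClauseAtSplitTwoQuad/Lines/m_line_pin.lean`) — LOCAL INPUTS AT `v̄`:
# the Frobenius of `K_v̄` in `Γ_K`, the `p`-adic avatar dictionary AT `v̄`, and the identification of the stub's `(τ, u)`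

Cell `bsd-print-cf2`, discharge-interface typer `bsd-print-cf2-ty2` g36 (literature-prover seat: Summits-side helpers go to the typer's
directory `Rank1Residual/P2/`, Theses-free, no item; consumer = the `m_line_pin` prover via `import`). THEOREMS ONLY (no `def`, no named fact, no `sorry`, no `instance`). HONEST FRAMING: nothing here closes the crux or a
registered stub; BSD is not proved by any of this; no summit statement is proved by this seat.

WHY. Stub (A) restricts the two-variable Katz measure `G₂` of the `θ_K⁻¹`-branch to the `v`-line (`π_v G₂ = G₂(T₁, 0)`, an
`IsNuBranch ι v (insert v̄ S) κ₁ γ₁⁻¹ θ_K⁻¹ Ω Ω_p` solution by `IsKatzMeasure₂.isKatzBranch_map_constantCoeff` + `IsKatzBranch.isNuBranch`)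
and compares it with Müller's `ν`-branch `G₁` of modulus `S'`. When `θ_K` is unramified at `v̄` (`S' = S`) the comparison inserts de Shalit's
Euler factor at `v̄` (II Thm. 4.12 (ii) (32)): the tree's `Muller2020.IsNuBranch.hasValueAt_insert_of_avatarAt_inv` (p703691) displays it as
`1 − C a · binomPow (−κ₁ σ)` GIVEN the avatar dictionary `ι⁻¹(ε(ϖ_v̄)) = a · r(σ)` at the interpolation points, while the stub writes it as
`(1+T) − u` for `τ ∈ D_v̄` with `κ₁ τ = κ₁ γ₁` and `θ(τ) = u` on `(F/𝓞)(θ)`. This file supplies, fact-free: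

* §1 `forall_of_dense_inertia_zpowers` — the density principle on `Γ_{K_w}`: a closed condition holding on `I_{K_w} · φ₀^ℤ` for a Frobenius
  lift `φ₀` (`IsFrobPow φ₀ 1`) holds everywhere (`dense_absInertia_mul_zpowers_of_isFrobPow`, Serre *Local Fields* XIII §1).
* §2 **`exists_frob_dictionary`** — THE AVATAR DICTIONARY AT `v̄ ∣ p` (the `hdict`/`hval` of p703691, DISCHARGED): a Frobenius lift `φ₀` of
  `K_v̄` such that for EVERY Hecke character `φ` of type `(k, 0)` unramified at `v̄` and EVERY `p`-adic avatar `r` of `φ`: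
  `r((res φ₀)⁻¹) = ι⁻¹(φ(ϖ_v̄))` — Serre's local algebraicity at a place of exponent `0` (`PNewDisplay.avatar_entry_eq_of_isPAdicAvatarOf`, X2,
  at the Weil element `u⁻¹` of degree `−1`, whose Artin image is a uniformiser; every local exponent vanishes by
  `embExponent_localEmbedding_eq_zero`).
* §3 `apply_absGaloisRestrict_ne_one` — `κ₁(res φ₀) ≠ 1` for the `v`-line `κ₁` (unramified outside `v`): else `κ₁` kills `I_v̄` and `φ₀`, hence
  `D_v̄` (§1), against «no place splits completely in a line» (`LineDoubleCoset.decomp_not_le_kerSubgroup_of_isUnramifiedOutside'`);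
  `isUnit_toAdd_apply_absGaloisRestrict` — `κ₁(res φ₀) ∈ ℤ_pˣ` as soon as some `τ ∈ D_v̄` has `κ₁ τ = 1 ∈ ℤ_p` (the stub's `τ`);
  **`unitChar_eq_unitChar_absGaloisRestrict`** (`p = 2`) — for `θ` unramified at `v̄`, `θ(τ) = θ(res φ₀)`: the pair `(κ₁, θ) ∘ res` maps the
  dense set `I_v̄ φ₀^ℤ` into the closed set `{(2ℤ₂·c, 1)} ∪ {((2ℤ₂+1)·c, −1)}` (resp. `{θ = 1}`), and `1 ∉ 2ℤ₂ c`.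
* §4 `intCast_eq_unitChar_of_forall_smul`, `eq_one_or_eq_neg_one_of_forall_smul` — the stub's `∀ m : (F/𝓞)(θ), τ • m = u • m` forces
  `(u : ℤ₂) = unitChar θ τ` (`charModuleEquiv_galois_smul` + faithfulness of `ℚ_p/ℤ_p`, `QpModZp.eq_zero_of_forall_smul_tgen_eq_zero`) and `u = ±1`.
* §5 `ne_zero_of_charIdeal_map_eq_span` — `G₁ ≠ 0` from the stub's Müller clause (a dual datum exists, `KellerYin2024.nonempty_unrDualData_char`;
  characteristic ideals over the domain `Λ` are non-zero, `Module.charIdeal_ne_bot`; `PowerSeries.map J` is injective).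

presearch: de Shalit 1987 II.4.12 (ii)/(iii), II.4.16 (49)–(50) (held, p. 66–67, 76–77); Serre 1968 III §2.3 (locally algebraic); Serre
*Local Fields* XIII §1 (density of Frobenius × inertia) — all cited in the imported tree files; no new fact. beyond-print theorem: no.

References: [deShalit1987] II Thm. 4.12 (ii), II.4.16–4.17; [SerreAbelianLadic1968] Ch. III §2.3; [SerreLocalFields1979] Ch. XIII §1, §4
Thm. 2; [Washington1997] §13.1; [KellerYin2024] §1.1.
-/

noncomputable section

set_option autoImplicit false

open scoped Classical NumberField Topology Pointwise
open NumberField IsDedekindDomain Field Filter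
open Literature Literature.NumberTheory.GaloisRepresentations Literature.NumberTheory.EllipticCurves
open Literature.NumberTheory.Automorphic
open Literature.NumberTheory.EllipticCurves.KellerYin2024 Literature.NumberTheory.EllipticCurves.GreenbergVatsal2000
open Literature.NumberTheory.IwasawaTheory
open Summit.BirchSwinnertonDyer.Rank1Residual.X2 Summit.BirchSwinnertonDyer.BirchSwinnertonDyer.Theorems
open Summit.BirchSwinnertonDyer.BirchSwinnertonDyer.Theorems.PrintCf2
open Summit.BirchSwinnertonDyer.BirchSwinnertonDyer.Theorems.PrintCf2.FiniteTwist

namespace Summit.BirchSwinnertonDyer.Rank1Residual.P2.VLineRestriction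

variable {p : ℕ} [Fact p.Prime] {K : Type} [Field K] [NumberField K]

/-! ## §1. The density principle on `Γ_{K_w}` -/

/-- **A closed condition on `Γ_{K_w}` holding on `I_{K_w} · φ₀^ℤ` holds everywhere**, for `φ₀` a Frobenius lift (`IsFrobPow φ₀ 1`):
`I_{K_w} · φ₀^ℤ` is dense (`dense_absInertia_mul_zpowers_of_isFrobPow`). [cite: SerreLocalFields1979, Ch. XIII §1 Prop. 1] -/
theorem forall_of_dense_inertia_zpowers {w : HeightOneSpectrum (𝓞 K)}
    {φ₀ : absoluteGaloisGroup (w.adicCompletion K)} (hφ₀ : IsFrobPow φ₀ 1)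
    {C : Set (absoluteGaloisGroup (w.adicCompletion K))} (hC : IsClosed C)
    (h : ∀ i ∈ absInertia (w.adicCompletion K), ∀ n : ℤ, i * φ₀ ^ n ∈ C) (z : absoluteGaloisGroup (w.adicCompletion K)) :
    z ∈ C := by
  have hd := dense_absInertia_mul_zpowers_of_isFrobPow (w.adicCompletion K) hφ₀
  have hsub : (absInertia (w.adicCompletion K) : Set (absoluteGaloisGroup (w.adicCompletion K))) *
      (Subgroup.zpowers φ₀ : Set (absoluteGaloisGroup (w.adicCompletion K))) ⊆ C := by
    rintro _ ⟨i, hi, x, hx, rfl⟩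
    obtain ⟨n, rfl⟩ := Subgroup.mem_zpowers_iff.mp hx
    exact h i hi n
  have hCu : C = Set.univ := by
    have h1 := (hd.mono hsub).closure_eq
    rwa [hC.closure_eq] at h1
  rw [hCu]; trivial

/-- The restriction of local inertia lies in the global inertia group `I_w ≤ Γ_K` of the chosen prime. [cite: NeukirchANT1999, Ch. II §9 Prop. (9.6)] -/
theorem absGaloisRestrict_mem_inertia (w : HeightOneSpectrum (𝓞 K)) {i : absoluteGaloisGroup (w.adicCompletion K)}
    (hi : i ∈ absInertia (w.adicCompletion K)) :
    absGaloisRestrict K (w.adicCompletion K) i ∈ GreenbergSelmer.inertia w :=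
  Subgroup.mem_map_of_mem _ hi

/-- … and in the inertia group of `𝔓₀ = adicCompletionPrime K w`. [cite: NeukirchANT1999, Ch. II §9 Prop. (9.6)] -/
theorem absGaloisRestrict_mem_inertia_adicCompletionPrime (w : HeightOneSpectrum (𝓞 K)) {i : absoluteGaloisGroup (w.adicCompletion K)}
    (hi : i ∈ absInertia (w.adicCompletion K)) :
    absGaloisRestrict K (w.adicCompletion K) i ∈ (adicCompletionPrime K w).inertia (absoluteGaloisGroup K) := by
  rw [inertia_adicCompletionPrime_eq_map_absInertia]
  exact Subgroup.mem_map_of_mem _ hi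

/-! ## §2. The avatar dictionary at `v̄ ∣ p` for characters of type `(k, 0)` -/

/-- **THE `p`-ADIC AVATAR DICTIONARY AT `v̄`.** `K` with all infinite places complex, `v̄ ≠ v` above `p`, `ι : ℚ̄_p ≃ ℂ` normalised by the
frames' clause `hι` (`ι⁻¹ ∘ w.embedding` induces `v`). There is a Frobenius lift `φ₀ ∈ Γ_{K_v̄}` (`IsFrobPow φ₀ 1`) such that for EVERY Hecke
character `φ` of infinity type `(k, 0)` unramified outside a finite set and AT `v̄`, and EVERY `p`-adic avatar `r` of `φ`
(`IsPAdicAvatarOf ι φ r`): **`r((res φ₀)⁻¹) = ι⁻¹(φ(ϖ_v̄))`** in `ℂ_p`. Proof: Serre's local algebraicity for any avatar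
(`PNewDisplay.avatar_entry_eq_of_isPAdicAvatarOf`) at the Weil element `u⁻¹` of degree `−1` (`u` of degree `1`), whose image under a local
Artin map is a uniformiser (Deligne's normalisation `IsLocalArtinMap.artin_frob`); all local exponents of the type `(k, 0)` at the embeddings
through `K_v̄` vanish (`embExponent_localEmbedding_eq_zero`), and `φ(⟨ϖ⟩_v̄) = φ(ϖ_v̄)` for unramified `φ`
(`localComponent_eq_valueAtUniformizer`). [cite: SerreAbelianLadic1968, Ch. III §2.3] [cite: SerreLocalFields1979, Ch. XIII §4 Thm. 2]
[cite: deShalit1987, II.4.12 (ii) (32) and II.1.1] -/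
theorem exists_frob_dictionary (ι : PadicAlgCl p ≃+* ℂ) (himag : ∀ w : InfinitePlace K, w.IsComplex)
    {v vbar : HeightOneSpectrum (𝓞 K)} (hvbar : ((p : ℕ) : 𝓞 K) ∈ vbar.asIdeal) (hne : vbar ≠ v)
    (hι : ∀ (w : InfinitePlace K) (d : 𝓞 K), d ∈ v.asIdeal ↔ ‖ι.symm (w.embedding (d : K))‖ < 1) :
    ∃ φ₀ : absoluteGaloisGroup (vbar.adicCompletion K), IsFrobPow φ₀ 1 ∧
      ∀ (φ : HeckeCharacter K) (k : ℤ) (T : Finset (HeightOneSpectrum (𝓞 K))) (r : FramedGaloisRep K (PadicAlgCl p) 1),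
        (∀ w, w ∉ T → φ.IsUnramifiedAt w) → φ.IsUnramifiedAt vbar →
        φ.HasInfinityType (fun _ ↦ k) (fun _ ↦ 0) → IsPAdicAvatarOf ι φ r →
        avatarValueAt r (absGaloisRestrict K (vbar.adicCompletion K) φ₀)⁻¹ =
          ((ι.symm (φ.valueAtUniformizer vbar) : PadicAlgCl p) : ℂ_[p]) := by
  obtain ⟨u, hu⟩ := ArtinLocalGlobal.exists_deg_eq_one vbar
  obtain ⟨a, ha⟩ := exists_isLocalArtinMap_holds (vbar.adicCompletion K)
  refine ⟨WeilGroup.toAbsGalois _ u, (WeilGroup.deg_eq_iff IsFrobPow.mul_holds IsFrobPow.unique_holds).mp hu,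
    fun φ k T r hT hunr hinf hav ↦ ?_⟩
  have hdeg : WeilGroup.deg u⁻¹ = -1 := by
    rw [WeilGroup.deg_inv IsFrobPow.mul_holds IsFrobPow.unique_holds, hu]
  have hϖ : Valued.v ((a u⁻¹ : (vbar.adicCompletion K)ˣ) : vbar.adicCompletion K) = WithZero.exp (-1 : ℤ) :=
    ArtinLocalGlobal.valued_eq_exp_neg_one_of_isUniformizer vbar (ha.artin_frob u⁻¹ hdeg)
  have hentry := PNewDisplay.avatar_entry_eq_of_isPAdicAvatarOf hinf ι hT hav hvbar a ha u⁻¹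
  have hprod : ∏ f : {e : vbar.adicCompletion K →+* PadicAlgCl p // Continuous e},
      f.1 ((a u⁻¹ : (vbar.adicCompletion K)ˣ) : vbar.adicCompletion K) ^
        (-HeckeCharacter.embExponent (fun _ : InfinitePlace K ↦ k) (fun _ ↦ (0 : ℤ))
          ((ι : PadicAlgCl p →+* ℂ).comp (f.1.comp (algebraMap K (vbar.adicCompletion K))))) = 1 := by
    refine Finset.prod_eq_one fun f _ ↦ ?_
    rw [embExponent_localEmbedding_eq_zero ι himag hne hι f.1 f.2 k, neg_zero, zpow_zero]
  rw [hprod, mul_one, ← HeckeCharacter.localComponent_apply, HeckeCharacter.localComponent_eq_valueAtUniformizer hunr hϖ] at hentry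
  rw [← map_inv, ← map_inv, PNewDisplay.avatarValueAt_eq_entry, hentry]

/-! ## §3. `κ₁` and `θ` on the decomposition group at `v̄` -/

section Decomp

variable {v vbar : HeightOneSpectrum (𝓞 K)}

/-- **`κ(res φ₀) ≠ 1` for a `ℤ_p`-line `κ` of the imaginary quadratic `K` unramified outside `v`** (`p = v v̄` split, `φ₀` a Frobenius lift of
`K_v̄`): otherwise `κ` kills `I_{K_v̄}` (unramified at `v̄ ≠ v`) and `φ₀`, hence the dense `I_{K_v̄}·φ₀^ℤ`, hence `D_v̄` — but no place of `K`
splits completely in a `ℤ_p`-line unramified outside one prime (`LineDoubleCoset.decomp_not_le_kerSubgroup_of_isUnramifiedOutside'`).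
[cite: deShalit1987, Ch. II §1.1] [cite: Washington1997, §13.1] -/
theorem apply_absGaloisRestrict_ne_one (hK : IsImaginaryQuadratic K) (hv : ((p : ℕ) : 𝓞 K) ∈ v.asIdeal)
    (hvbar : ((p : ℕ) : 𝓞 K) ∈ vbar.asIdeal) (hne : vbar ≠ v) {κ : ZpExtension K p} (hκ : κ.IsUnramifiedOutside v)
    {φ₀ : absoluteGaloisGroup (vbar.adicCompletion K)} (hφ₀ : IsFrobPow φ₀ 1) :
    κ (absGaloisRestrict K (vbar.adicCompletion K) φ₀) ≠ 1 := by
  intro h1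
  refine LineDoubleCoset.decomp_not_le_kerSubgroup_of_isUnramifiedOutside' hK hvbar hv hne.symm κ hκ vbar ?_
  rintro τ ⟨z, rfl⟩
  have hcont : Continuous fun z : absoluteGaloisGroup (vbar.adicCompletion K) ↦ κ (absGaloisRestrict K (vbar.adicCompletion K) z) :=
    (map_continuous κ).comp (map_continuous _)
  have key := forall_of_dense_inertia_zpowers hφ₀
    (C := {z | κ (absGaloisRestrict K (vbar.adicCompletion K) z) = 1}) (isClosed_singleton.preimage hcont) (fun i hi n ↦ by
      have hi1 : κ (absGaloisRestrict K (vbar.adicCompletion K) i) = 1 :=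
        ZpExtension.mem_kerSubgroup.mp (hκ.inertia_le hne (absGaloisRestrict_mem_inertia vbar hi))
      show κ (absGaloisRestrict K (vbar.adicCompletion K) (i * φ₀ ^ n)) = 1
      rw [map_mul, map_mul, map_zpow, map_zpow, hi1, h1, one_zpow, one_mul]) z
  exact ZpExtension.mem_kerSubgroup.mpr key

/-- **`κ(res φ₀)` is a unit of `ℤ_p` as soon as some `τ ∈ D_v̄` has `κ τ = 1 ∈ ℤ_p`** (`κ` unramified at `v̄`): the coordinate `κ ∘ res`
maps the dense `I_{K_v̄}·φ₀^ℤ` into the closed `ℤ_p · κ(res φ₀)`, so `1 = e · κ(res φ₀)`. [cite: SerreLocalFields1979, Ch. XIII §1] -/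
theorem isUnit_toAdd_apply_absGaloisRestrict {κ : ZpExtension K p} (hκv : GreenbergSelmer.inertia vbar ≤ κ.kerSubgroup)
    {φ₀ : absoluteGaloisGroup (vbar.adicCompletion K)} (hφ₀ : IsFrobPow φ₀ 1)
    {τ : absoluteGaloisGroup K} (hτ : τ ∈ GreenbergSelmer.decomp vbar) (hκτ : κ τ = Multiplicative.ofAdd 1) :
    IsUnit (Multiplicative.toAdd (κ (absGaloisRestrict K (vbar.adicCompletion K) φ₀))) := by
  obtain ⟨y, rfl⟩ := (GreenbergSelmer.mem_decomp_iff vbar τ).mp hτ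
  have hcont : Continuous fun z : absoluteGaloisGroup (vbar.adicCompletion K) ↦
      Multiplicative.toAdd (κ (absGaloisRestrict K (vbar.adicCompletion K) z)) :=
    continuous_toAdd.comp ((map_continuous κ).comp (map_continuous _))
  have hclosed : IsClosed (Set.range fun e : ℤ_[p] ↦
      e * Multiplicative.toAdd (κ (absGaloisRestrict K (vbar.adicCompletion K) φ₀))) :=
    (isCompact_range (continuous_id.mul continuous_const)).isClosed
  have key := forall_of_dense_inertia_zpowers hφ₀
    (C := {z | Multiplicative.toAdd (κ (absGaloisRestrict K (vbar.adicCompletion K) z)) ∈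
      Set.range fun e : ℤ_[p] ↦ e * Multiplicative.toAdd (κ (absGaloisRestrict K (vbar.adicCompletion K) φ₀))})
    (hclosed.preimage hcont) (fun i hi n ↦ by
      have hi1 : κ (absGaloisRestrict K (vbar.adicCompletion K) i) = 1 :=
        ZpExtension.mem_kerSubgroup.mp (hκv (absGaloisRestrict_mem_inertia vbar hi))
      refine ⟨(n : ℤ_[p]), ?_⟩
      show (n : ℤ_[p]) * Multiplicative.toAdd (κ (absGaloisRestrict K (vbar.adicCompletion K) φ₀)) =
        Multiplicative.toAdd (κ (absGaloisRestrict K (vbar.adicCompletion K) (i * φ₀ ^ n)))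
      rw [map_mul, map_mul, map_zpow, map_zpow, hi1, one_mul, toAdd_zpow, zsmul_eq_mul]) y
  obtain ⟨e, he⟩ := key
  rw [hκτ, toAdd_ofAdd] at he
  exact IsUnit.of_mul_eq_one_right e he

omit [NumberField K] in
/-- `unitChar θ σ = ±1` for a quadratic framed `θ`. [cite: KellerYin2024, §1.1] -/
theorem unitChar_eq_one_or_eq_neg_one {θ : FramedGaloisRep K (padicCoeffIntegers (∅ : Set (PadicAlgCl p))) 1}
    (hθ : ∀ σ : absoluteGaloisGroup K, θ σ ^ 2 = 1) (σ : absoluteGaloisGroup K) :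
    unitChar θ σ = 1 ∨ unitChar θ σ = -1 := by
  have h2 : unitChar θ σ ^ 2 = 1 := unitChar_pow_eq_one θ hθ σ
  have h3 : ((unitChar θ σ : ℤ_[p]ˣ) : ℤ_[p]) * ((unitChar θ σ : ℤ_[p]ˣ) : ℤ_[p]) = 1 := by
    rw [← sq, ← Units.val_pow_eq_pow_val, h2, Units.val_one]
  rcases mul_self_eq_one_iff.mp h3 with h | h
  · exact Or.inl (Units.ext h)
  · exact Or.inr (Units.ext (by rw [h, Units.val_neg, Units.val_one]))

/-- `θ` unramified at `v̄` kills the restriction of the local inertia group: `unitChar θ (res i) = 1`. [cite: NeukirchANT1999, Ch. II §9 Prop. (9.6)] -/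
theorem unitChar_absGaloisRestrict_eq_one_of_mem_absInertia
    (θ : FramedGaloisRep K (padicCoeffIntegers (∅ : Set (PadicAlgCl p))) 1) (hθv : θ.IsUnramifiedAt vbar)
    {i : absoluteGaloisGroup (vbar.adicCompletion K)} (hi : i ∈ absInertia (vbar.adicCompletion K)) :
    unitChar θ (absGaloisRestrict K (vbar.adicCompletion K) i) = 1 :=
  unitChar_eq_one_of_apply_eq_one θ
    (hθv _ (adicCompletionPrime_mem_primesAbove K vbar) _ (absGaloisRestrict_mem_inertia_adicCompletionPrime vbar hi))

/-- `(-1)^(2k) = 1` in the unit group of a ring. [folklore] -/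
theorem neg_one_zpow_two_mul {M : Type*} [Monoid M] [HasDistribNeg M] (k : ℤ) : ((-1 : Mˣ)) ^ (2 * k) = 1 := by
  rw [zpow_mul, zpow_two, neg_mul_neg, one_mul, one_zpow]

/-- `(-1)^(2k+1) = -1` in the unit group of a ring. [folklore] -/
theorem neg_one_zpow_two_mul_add_one {M : Type*} [Monoid M] [HasDistribNeg M] (k : ℤ) :
    ((-1 : Mˣ)) ^ (2 * k + 1) = -1 := by
  rw [zpow_add, zpow_one, neg_one_zpow_two_mul, one_mul]

/-- `‖2‖ < 1` in `ℤ₂`, hence `2 e c ≠ 1`. [folklore] -/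
theorem two_mul_mul_ne_one (e c : ℤ_[2]) : 2 * e * c ≠ 1 := by
  intro h
  have h2 : ‖(2 : ℤ_[2])‖ < 1 := by
    have h0 := PadicInt.norm_p (p := 2)
    simp only [Nat.cast_ofNat] at h0
    rw [h0]; norm_num
  have hn : ‖(2 : ℤ_[2]) * e * c‖ < 1 := by
    rw [norm_mul, norm_mul]
    calc ‖(2 : ℤ_[2])‖ * ‖e‖ * ‖c‖ ≤ ‖(2 : ℤ_[2])‖ * 1 * 1 := by
          gcongr
          · exact PadicInt.norm_le_one e
          · exact PadicInt.norm_le_one c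
      _ < 1 := by rw [mul_one, mul_one]; exact h2
  rw [h, norm_one] at hn
  exact lt_irrefl _ hn

/-- **`θ(τ) = θ(res φ₀)` at `p = 2`.** For a quadratic framed `θ` unramified at `v̄`, a `ℤ₂`-line `κ` unramified at `v̄`, a Frobenius lift `φ₀`
of `K_v̄` and `τ ∈ D_v̄` with `κ τ = 1 ∈ ℤ₂`: `unitChar θ τ = unitChar θ (res φ₀)`. If `s := θ(res φ₀) = 1`, `θ ∘ res` kills the dense
`I_{K_v̄} φ₀^ℤ`; if `s = −1`, `(κ, θ) ∘ res` maps `i φ₀ⁿ ↦ (n c, (−1)ⁿ)` into the closed set `(2ℤ₂ c × {1}) ∪ ((2ℤ₂ + 1) c × {−1})`, and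
`κ τ = 1 ∉ 2ℤ₂ c`. [cite: SerreLocalFields1979, Ch. XIII §1] [cite: deShalit1987, II.4.12 (ii)] -/
theorem unitChar_eq_unitChar_absGaloisRestrict {κ : ZpExtension K 2} (hκv : GreenbergSelmer.inertia vbar ≤ κ.kerSubgroup)
    (θ : FramedGaloisRep K (padicCoeffIntegers (∅ : Set (PadicAlgCl 2))) 1) (hθ : ∀ σ : absoluteGaloisGroup K, θ σ ^ 2 = 1)
    (hθv : θ.IsUnramifiedAt vbar) {φ₀ : absoluteGaloisGroup (vbar.adicCompletion K)} (hφ₀ : IsFrobPow φ₀ 1)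
    {τ : absoluteGaloisGroup K} (hτ : τ ∈ GreenbergSelmer.decomp vbar) (hκτ : κ τ = Multiplicative.ofAdd 1) :
    unitChar θ τ = unitChar θ (absGaloisRestrict K (vbar.adicCompletion K) φ₀) := by
  obtain ⟨y, rfl⟩ := (GreenbergSelmer.mem_decomp_iff vbar τ).mp hτ
  have hcκ : Continuous fun z : absoluteGaloisGroup (vbar.adicCompletion K) ↦
      Multiplicative.toAdd (κ (absGaloisRestrict K (vbar.adicCompletion K) z)) :=
    continuous_toAdd.comp ((map_continuous κ).comp (map_continuous _))
  have hcθ : Continuous fun z : absoluteGaloisGroup (vbar.adicCompletion K) ↦ unitChar θ (absGaloisRestrict K (vbar.adicCompletion K) z) :=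
    (map_continuous (unitChar θ)).comp (map_continuous _)
  -- values on the dense set
  have hκval : ∀ i ∈ absInertia (vbar.adicCompletion K), ∀ n : ℤ,
      Multiplicative.toAdd (κ (absGaloisRestrict K (vbar.adicCompletion K) (i * φ₀ ^ n))) =
        (n : ℤ_[2]) * Multiplicative.toAdd (κ (absGaloisRestrict K (vbar.adicCompletion K) φ₀)) := by
    intro i hi n
    have hi1 : κ (absGaloisRestrict K (vbar.adicCompletion K) i) = 1 :=
      ZpExtension.mem_kerSubgroup.mp (hκv (absGaloisRestrict_mem_inertia vbar hi))
    rw [map_mul, map_mul, map_zpow, map_zpow, hi1, one_mul, toAdd_zpow, zsmul_eq_mul]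
  have hθval : ∀ i ∈ absInertia (vbar.adicCompletion K), ∀ n : ℤ,
      unitChar θ (absGaloisRestrict K (vbar.adicCompletion K) (i * φ₀ ^ n)) =
        unitChar θ (absGaloisRestrict K (vbar.adicCompletion K) φ₀) ^ n := by
    intro i hi n
    rw [map_mul, map_mul, map_zpow, map_zpow, unitChar_absGaloisRestrict_eq_one_of_mem_absInertia θ hθv hi, one_mul]
  rcases unitChar_eq_one_or_eq_neg_one hθ (absGaloisRestrict K (vbar.adicCompletion K) φ₀) with h1 | h1
  · -- `s = 1`: `θ ∘ res` kills everything
    have key := forall_of_dense_inertia_zpowers hφ₀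
      (C := {z | unitChar θ (absGaloisRestrict K (vbar.adicCompletion K) z) = 1}) (isClosed_singleton.preimage hcθ)
      (fun i hi n ↦ by
        show unitChar θ (absGaloisRestrict K (vbar.adicCompletion K) (i * φ₀ ^ n)) = 1
        rw [hθval i hi n, h1, one_zpow]) y
    rw [h1]
    exact key
  · -- `s = -1`: parity
    have hclosed₀ : IsClosed (Set.range fun e : ℤ_[2] ↦
        2 * e * Multiplicative.toAdd (κ (absGaloisRestrict K (vbar.adicCompletion K) φ₀))) :=
      (isCompact_range ((continuous_const.mul continuous_id).mul continuous_const)).isClosed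
    have hclosed₁ : IsClosed (Set.range fun e : ℤ_[2] ↦
        (2 * e + 1) * Multiplicative.toAdd (κ (absGaloisRestrict K (vbar.adicCompletion K) φ₀))) :=
      (isCompact_range (((continuous_const.mul continuous_id).add continuous_const).mul continuous_const)).isClosed
    have key := forall_of_dense_inertia_zpowers hφ₀
      (C := {z | (Multiplicative.toAdd (κ (absGaloisRestrict K (vbar.adicCompletion K) z)) ∈
            Set.range (fun e : ℤ_[2] ↦ 2 * e * Multiplicative.toAdd (κ (absGaloisRestrict K (vbar.adicCompletion K) φ₀))) ∧
          unitChar θ (absGaloisRestrict K (vbar.adicCompletion K) z) = 1) ∨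
        (Multiplicative.toAdd (κ (absGaloisRestrict K (vbar.adicCompletion K) z)) ∈
            Set.range (fun e : ℤ_[2] ↦ (2 * e + 1) * Multiplicative.toAdd (κ (absGaloisRestrict K (vbar.adicCompletion K) φ₀))) ∧
          unitChar θ (absGaloisRestrict K (vbar.adicCompletion K) z) = -1)})
      (((hclosed₀.preimage hcκ).inter (isClosed_singleton.preimage hcθ)).union
        ((hclosed₁.preimage hcκ).inter (isClosed_singleton.preimage hcθ)))
      (fun i hi n ↦ by
        show (Multiplicative.toAdd (κ (absGaloisRestrict K (vbar.adicCompletion K) (i * φ₀ ^ n))) ∈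
              Set.range (fun e : ℤ_[2] ↦ 2 * e * Multiplicative.toAdd (κ (absGaloisRestrict K (vbar.adicCompletion K) φ₀))) ∧
            unitChar θ (absGaloisRestrict K (vbar.adicCompletion K) (i * φ₀ ^ n)) = 1) ∨
          (Multiplicative.toAdd (κ (absGaloisRestrict K (vbar.adicCompletion K) (i * φ₀ ^ n))) ∈
              Set.range (fun e : ℤ_[2] ↦ (2 * e + 1) * Multiplicative.toAdd (κ (absGaloisRestrict K (vbar.adicCompletion K) φ₀))) ∧
            unitChar θ (absGaloisRestrict K (vbar.adicCompletion K) (i * φ₀ ^ n)) = -1)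
        rw [hκval i hi n, hθval i hi n, h1]
        obtain ⟨k, rfl | rfl⟩ := Int.even_or_odd' n
        · exact Or.inl ⟨⟨(k : ℤ_[2]), by push_cast; ring⟩, neg_one_zpow_two_mul k⟩
        · exact Or.inr ⟨⟨(k : ℤ_[2]), by push_cast; ring⟩, neg_one_zpow_two_mul_add_one k⟩) y
    rcases key with ⟨⟨e, he⟩, -⟩ | ⟨-, h2⟩
    · exfalso
      rw [hκτ, toAdd_ofAdd] at he
      exact two_mul_mul_ne_one e _ he
    · rw [h2, h1]

end Decomp

/-! ## §4. The stub's `(τ, u)`: `τ • m = u • m` on `(F/𝓞)(θ)` forces `u = θ(τ) = ±1` -/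

section Faithful

omit [NumberField K] in
/-- **`(u : ℤ_p) = unitChar θ τ`** when `τ` acts on `(F/𝓞)(θ) ≃ ℚ_p/ℤ_p` (`charModuleEquiv`, `Γ_K`-equivariant for `unitChar θ`:
`charModuleEquiv_galois_smul`) as multiplication by the integer `u`: `ℚ_p/ℤ_p` is a faithful `ℤ_p`-module
(`QpModZp.eq_zero_of_forall_smul_tgen_eq_zero`). [cite: KellerYin2024, §1.1 (arXiv:2402.12781v2 TeX L441–449)] [cite: Greenberg2006, p. 342 L2–5] -/
theorem intCast_eq_unitChar_of_forall_smul (θ : FramedGaloisRep K (padicCoeffIntegers (∅ : Set (PadicAlgCl p))) 1)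
    {τ : absoluteGaloisGroup K} {u : ℤ} (h : ∀ m : charModule (∅ : Set (PadicAlgCl p)) θ, τ • m = u • m) :
    (u : ℤ_[p]) = ((unitChar θ τ : ℤ_[p]ˣ) : ℤ_[p]) := by
  have key : ∀ b : QpModZp p, (((unitChar θ τ : ℤ_[p]ˣ) : ℤ_[p]) - (u : ℤ_[p])) • b = 0 := by
    intro b
    obtain ⟨m, rfl⟩ := (charModuleEquiv θ).surjective b
    rw [sub_smul, ← charModuleEquiv_galois_smul, h m, map_zsmul, Int.cast_smul_eq_zsmul, sub_self]
  have h0 := QpModZp.eq_zero_of_forall_smul_tgen_eq_zero (p := p) (fun n ↦ key _)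
  exact (sub_eq_zero.mp h0).symm

omit [NumberField K] in
/-- **`u = 1 ∨ u = −1`** for the stub's integer `u` (`θ` quadratic). [cite: KellerYin2024, §1.1] -/
theorem eq_one_or_eq_neg_one_of_forall_smul {θ : FramedGaloisRep K (padicCoeffIntegers (∅ : Set (PadicAlgCl p))) 1}
    (hθ : ∀ σ : absoluteGaloisGroup K, θ σ ^ 2 = 1) {τ : absoluteGaloisGroup K} {u : ℤ}
    (h : ∀ m : charModule (∅ : Set (PadicAlgCl p)) θ, τ • m = u • m) : u = 1 ∨ u = -1 := by
  have h1 := intCast_eq_unitChar_of_forall_smul θ h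
  rcases unitChar_eq_one_or_eq_neg_one hθ τ with h2 | h2
  · left
    rw [h2, Units.val_one] at h1
    exact_mod_cast h1
  · right
    rw [h2, Units.val_neg, Units.val_one] at h1
    exact_mod_cast h1

omit [NumberField K] in
/-- The avatar value of the base change `θ̃ : Γ_K → GL₁(ℚ̄_p)` at `τ` IS the integer `u`, inside `𝒪_{ℂ_p}`. [cite: KellerYin2024, §1.1] -/
theorem avatarValueAt_baseChange_eq_intCast_of_forall_smul (θ : FramedGaloisRep K (padicCoeffIntegers (∅ : Set (PadicAlgCl p))) 1)
    {τ : absoluteGaloisGroup K} {u : ℤ} (h : ∀ m : charModule (∅ : Set (PadicAlgCl p)) θ, τ • m = u • m) :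
    avatarValueAt (FramedRep.baseChange (padicCoeffIntegers (∅ : Set (PadicAlgCl p))).subtype continuous_subtype_val θ) τ =
      ((u : PadicComplexInt p) : ℂ_[p]) := by
  rw [avatarValueAt_baseChange_subtype_empty, ← intCast_eq_unitChar_of_forall_smul θ h, map_intCast]

end Faithful

/-! ## §5. `G₁ ≠ 0` from the Müller clause of the stub -/

section NonZero

/-- `PowerSeries.map` along an injective ring map is injective. [folklore] -/
theorem powerSeries_map_injective {R S : Type*} [Semiring R] [Semiring S] {f : R →+* S} (hf : Function.Injective f) :
    Function.Injective (PowerSeries.map f) := by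
  intro F G hFG
  ext n
  apply hf
  rw [← PowerSeries.coeff_map, ← PowerSeries.coeff_map, hFG]

/-- The structure map `J₀ : ℤ₂ → 𝒪_{ℂ₂}` is injective. [folklore] -/
theorem padicIntToComplexInt_injective : Function.Injective (IntSeries.padicIntToComplexInt p) := by
  intro x y hxy
  have h := congrArg (fun z : PadicComplexInt p ↦ (z : ℂ_[p])) hxy
  simp only [IntSeries.coe_padicIntToComplexInt] at h
  exact Subtype.ext ((algebraMap ℚ_[p] (PadicAlgCl p)).injective (UniformSpace.Completion.coe_inj.mp h))

/-- **`G₁ ≠ 0`**: the stub's clause «every dual datum `D₁` of `H¹_nr(K^{(v)}_∞, A_θ)` is f.g. torsion with `(ch_Λ D₁.X)^J = (G₁)` for every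
structure-compatible `J`» forces `G₁ ≠ 0` — a datum exists (`KellerYin2024.nonempty_unrDualData_char`), `J₀ = padicIntToComplexInt` is
structure-compatible and injective, and characteristic ideals over the domain `Λ = ℤ₂⟦T⟧` are non-zero (`Module.charIdeal_ne_bot`).
[cite: KellerYin2024, Thm. 1.2.2] [cite: Washington1997, §13.2] -/
theorem ne_zero_of_charIdeal_map_eq_span {κ : ZpExtension K p} {γ : absoluteGaloisGroup K} (hγ : κ.IsTopGenerator γ)
    (θ : FramedGaloisRep K (padicCoeffIntegers (∅ : Set (PadicAlgCl p))) 1) (vbar : HeightOneSpectrum (𝓞 K))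
    {G₁ : PowerSeries (PadicComplexInt p)}
    (h : ∀ D₁ : DatumDualData κ γ (charModule (∅ : Set (PadicAlgCl p)) θ)
        (Castella2018.AcSelmer.bdpData (charModule (∅ : Set (PadicAlgCl p)) θ) p vbar) ∅,
      Module.Finite (IwasawaAlgebra p) D₁.X ∧ Module.IsTorsion (IwasawaAlgebra p) D₁.X ∧
      ∀ (J : ℤ_[p] →+* PadicComplexInt p),
        (∀ x : ℤ_[p], ((J x : PadicComplexInt p) : ℂ_[p]) = ((x : ℚ_[p]) : ℂ_[p])) →
        (Module.charIdeal (IwasawaAlgebra p) D₁.X).map (PowerSeries.map J) = Ideal.span {G₁}) :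
    G₁ ≠ 0 := by
  obtain ⟨D₁⟩ := nonempty_unrDualData_char (∅ : Set (PadicAlgCl p)) θ κ vbar ∅ hγ
  obtain ⟨-, -, hJ⟩ := h D₁
  have h1 := hJ (IntSeries.padicIntToComplexInt p) (IntSeries.coe_padicIntToComplexInt (p := p))
  intro h0
  rw [h0, Ideal.span_singleton_eq_bot.mpr rfl,
    Ideal.map_eq_bot_iff_of_injective (powerSeries_map_injective padicIntToComplexInt_injective)] at h1
  exact Module.charIdeal_ne_bot (IwasawaAlgebra p) D₁.X h1

end NonZero

end Summit.BirchSwinnertonDyer.Rank1Residual.P2.VLineRestriction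

end
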